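import Summits.Ventures.PercRepro.RLSRuleThreePoint

/-!
# PercRepro — the class structure of an independent set along a line: at most ONE coplanar triple
(night-3, gen 3)

The loss inventory of the lane (`proofs/N3-R3PLUS-plan.md` §1 (L3), §4.3–4.5; `N3-TAIL-LOSSY.md` §2) counts the
witnesses `X ⊆ K` that contain a «`3`-class along a line `ℓ` of `G`» — three points of `K` coplanar with `ℓ` — and
relies on the class structure «`Σ_j (c_j − 1) ≤ 2` (`W` is a basis: `dim span(W) ≤ 2 + #classes`)», i.e. on the fact
that `K` carries AT MOST ONE such triple per line.  This file proves that fact in the kernel by rank counting: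

* `eRk_insert_eq_three_of_notMem_closure`: a point off a line spans a plane with it;
* `closure_union_eq_of_coplanar`: a coplanar triple `C` and a point `y ∈ C` span the same plane over `ℓ`;
* **`card_coplanar_triples_le_one`**: for a line `ℓ` (rank `2`) and an independent `K` off `cl ℓ`, at most one
  `3`-subset `C ⊆ K` has `ρ(ℓ ∪ C) ≤ 3` — two such triples `C ≠ C′` would put `ℓ ∪ C ∪ C′` in rank `≤ |C ∪ C′| − 1`
  (one plane if they meet, two planes through `ℓ` if not), and then `ρ(ℓ ∪ K) ≤ |K| − 1 < ρ(K)`.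
Imports `RLSRuleThreePoint`.  Axioms: standard.
-/

open scoped Matroid

namespace PercRepro

namespace NightThree

open Finset ThmH PerFlat

variable {α : Type*} [DecidableEq α] {M : Matroid α} [M.Finite]

omit [DecidableEq α] [M.Finite] in
/-- A point of the ground set off the closure of a rank-`2` set spans rank `3` with it. -/
theorem eRk_insert_eq_three_of_notMem_closure {ℓ : Finset α} (hℓ : M.eRk (ℓ : Set α) = 2) {y : α}
    (hyE : y ∈ M.E) (hy : y ∉ M.closure (ℓ : Set α)) : M.eRk (insert y (ℓ : Set α)) = 3 := by
  rw [Matroid.eRk_insert_eq_add_one ⟨hyE, hy⟩, hℓ]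
  rfl

/-- A coplanar triple over `ℓ` and any of its points span the same plane: `cl(ℓ ∪ C) = cl(ℓ ∪ {y})`. -/
theorem closure_union_eq_of_coplanar {ℓ C : Finset α} (hℓ : M.eRk (ℓ : Set α) = 2) (hℓE : ℓ ⊆ gr M)
    (hCE : C ⊆ gr M) (hC : M.eRk ((ℓ ∪ C : Finset α) : Set α) ≤ 3) {y : α} (hyC : y ∈ C)
    (hy : y ∉ M.closure (ℓ : Set α)) :
    M.closure (insert y (ℓ : Set α)) = M.closure ((ℓ ∪ C : Finset α) : Set α) := by
  have hyE : y ∈ M.E := by rw [← coe_gr M]; exact Finset.mem_coe.2 (hCE hyC)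
  have hsub : insert y (ℓ : Set α) ⊆ M.closure ((ℓ ∪ C : Finset α) : Set α) := by
    refine Set.insert_subset ?_ ?_
    · apply M.subset_closure _ (by rw [← coe_gr M]; exact Finset.coe_subset.2 (Finset.union_subset hℓE hCE))
      rw [Finset.coe_union]
      exact Set.mem_union_right _ (Finset.mem_coe.2 hyC)
    · refine (M.subset_closure _ (by rw [← coe_gr M]; exact Finset.coe_subset.2 (Finset.union_subset hℓE hCE))).trans' ?_
      rw [Finset.coe_union]
      exact Set.subset_union_left
  apply closure_eq_of_subset_flat (M.isFlat_closure _) hsub (Set.toFinite _)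
  rw [M.eRk_closure_eq, eRk_insert_eq_three_of_notMem_closure hℓ hyE hy]
  exact hC

omit [M.Finite] in
/-- The rank of `ℓ ∪ K` is at least `|K|` for an independent `K`. -/
theorem card_le_eRk_union_of_indep {ℓ K : Finset α} (hK : M.Indep (K : Set α)) :
    (K.card : ℕ∞) ≤ M.eRk ((ℓ ∪ K : Finset α) : Set α) := by
  rw [← eRk_eq_card_of_indep hK]
  exact M.eRk_mono (Finset.coe_subset.2 Finset.subset_union_right)

/-- **At most one coplanar triple.**  For a line `ℓ` (rank `2`) and an independent `K` off `cl ℓ`, at most one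
`3`-subset `C ⊆ K` satisfies `ρ(ℓ ∪ C) ≤ 3`. -/
theorem card_coplanar_triples_le_one {ℓ K : Finset α} (hℓ : M.eRk (ℓ : Set α) = 2) (hℓE : ℓ ⊆ gr M)
    (hK : M.Indep (K : Set α)) (hoff : ∀ y ∈ K, y ∉ M.closure (ℓ : Set α)) :
    ((K.powersetCard 3).filter (fun C => M.eRk ((ℓ ∪ C : Finset α) : Set α) ≤ 3)).card ≤ 1 := by
  classical
  have hKE : K ⊆ gr M := by
    rw [← Finset.coe_subset, coe_gr]
    exact hK.subset_ground
  rw [Finset.card_le_one]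
  intro C hC C' hC'
  rw [Finset.mem_filter, Finset.mem_powersetCard] at hC hC'
  obtain ⟨⟨hCK, hCc⟩, hCr⟩ := hC
  obtain ⟨⟨hC'K, hC'c⟩, hC'r⟩ := hC'
  by_contra hne
  -- the union `U = C ∪ C′` has at least `4` points and `ρ(ℓ ∪ U) ≤ |U| − 1`
  set U := C ∪ C' with hU
  have hUK : U ⊆ K := Finset.union_subset hCK hC'K
  have hUc : 4 ≤ U.card := by
    have h1 := Finset.card_union_add_card_inter C C'
    have h2 : (C ∩ C').card ≤ 2 := by
      by_contra h
      push Not at h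
      have heq : C ∩ C' = C := Finset.eq_of_subset_of_card_le Finset.inter_subset_left (by omega)
      have heq' : C ∩ C' = C' := Finset.eq_of_subset_of_card_le Finset.inter_subset_right (by omega)
      exact hne (heq.symm.trans heq')
    rw [← hU] at h1
    omega
  have hrank : M.eRk ((ℓ ∪ U : Finset α) : Set α) + 1 ≤ (U.card : ℕ∞) := by
    rcases Finset.eq_empty_or_nonempty (C ∩ C') with hdisj | ⟨y, hy⟩
    · -- disjoint: two planes through `ℓ`, rank `≤ 4`, `|U| = 6`
      have h6 : U.card = 6 := by
        have h1 := Finset.card_union_add_card_inter C C'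
        rw [hdisj, Finset.card_empty, ← hU] at h1
        omega
      have hsub := M.eRk_inter_add_eRk_union_le ((ℓ ∪ C : Finset α) : Set α) ((ℓ ∪ C' : Finset α) : Set α)
      have hinter : (2 : ℕ∞) ≤ M.eRk (((ℓ ∪ C : Finset α) : Set α) ∩ ((ℓ ∪ C' : Finset α) : Set α)) := by
        rw [← hℓ]
        apply M.eRk_mono
        rw [Finset.coe_union, Finset.coe_union]
        exact Set.subset_inter Set.subset_union_left Set.subset_union_left
      have hunion : ((ℓ ∪ U : Finset α) : Set α) = ((ℓ ∪ C : Finset α) : Set α) ∪ ((ℓ ∪ C' : Finset α) : Set α) := by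
        rw [hU, Finset.coe_union, Finset.coe_union, Finset.coe_union, Finset.coe_union]
        ext x
        simp only [Set.mem_union]
        tauto
      rw [hunion]
      obtain ⟨a, ha, _⟩ := eRk_eq_nat M (ℓ ∪ C)
      obtain ⟨b, hb, _⟩ := eRk_eq_nat M (ℓ ∪ C')
      obtain ⟨c, hc, _⟩ := eRk_eq_nat M ((ℓ ∪ C) ∪ (ℓ ∪ C'))
      obtain ⟨d, hd, _⟩ := eRk_eq_nat M ((ℓ ∪ C) ∩ (ℓ ∪ C'))
      have hcoe : M.eRk (((ℓ ∪ C : Finset α) : Set α) ∪ ((ℓ ∪ C' : Finset α) : Set α)) = c := by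
        rw [← hc]
        simp only [Finset.coe_union]
      have hcoe' : M.eRk (((ℓ ∪ C : Finset α) : Set α) ∩ ((ℓ ∪ C' : Finset α) : Set α)) = d := by
        rw [← hd]
        simp only [Finset.coe_inter, Finset.coe_union]
      rw [ha] at hCr
      rw [hb] at hC'r
      rw [hcoe, hcoe', ha, hb] at hsub
      rw [hcoe'] at hinter
      rw [hcoe, h6]
      have ha' : a ≤ 3 := by exact_mod_cast hCr
      have hb' : b ≤ 3 := by exact_mod_cast hC'r
      have hd' : 2 ≤ d := by exact_mod_cast hinter
      have hsub' : d + c ≤ a + b := by exact_mod_cast hsub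
      have : c + 1 ≤ 6 := by omega
      exact_mod_cast this
    · -- they meet in `y`: one plane `cl(ℓ ∪ {y})` contains both, rank `≤ 3`, `|U| ≥ 4`
      rw [Finset.mem_inter] at hy
      have hyoff : y ∉ M.closure (ℓ : Set α) := hoff y (hCK hy.1)
      have hcl := closure_union_eq_of_coplanar hℓ hℓE (hCK.trans hKE) hCr hy.1 hyoff
      have hcl' := closure_union_eq_of_coplanar hℓ hℓE (hC'K.trans hKE) hC'r hy.2 hyoff
      have hsubU : ((ℓ ∪ U : Finset α) : Set α) ⊆ M.closure ((ℓ ∪ C : Finset α) : Set α) := by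
        have hE : ((ℓ ∪ C' : Finset α) : Set α) ⊆ M.E := by
          rw [← coe_gr M]; exact Finset.coe_subset.2 (Finset.union_subset hℓE (hC'K.trans hKE))
        have h1 : ((ℓ ∪ C' : Finset α) : Set α) ⊆ M.closure ((ℓ ∪ C : Finset α) : Set α) := by
          rw [← hcl, hcl']
          exact M.subset_closure _ hE
        have h2 : ((ℓ ∪ C : Finset α) : Set α) ⊆ M.closure ((ℓ ∪ C : Finset α) : Set α) :=
          M.subset_closure _ (by rw [← coe_gr M]; exact Finset.coe_subset.2 (Finset.union_subset hℓE (hCK.trans hKE)))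
        rw [hU, Finset.coe_union, Finset.coe_union]
        intro x hx
        rcases hx with hx | hx
        · exact h2 (by rw [Finset.coe_union]; exact Or.inl hx)
        · rcases hx with hx | hx
          · exact h2 (by rw [Finset.coe_union]; exact Or.inr hx)
          · exact h1 (by rw [Finset.coe_union]; exact Or.inr hx)
      have h3 : M.eRk ((ℓ ∪ U : Finset α) : Set α) ≤ 3 := by
        calc M.eRk ((ℓ ∪ U : Finset α) : Set α) ≤ M.eRk (M.closure ((ℓ ∪ C : Finset α) : Set α)) := M.eRk_mono hsubU
          _ = M.eRk ((ℓ ∪ C : Finset α) : Set α) := M.eRk_closure_eq _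
          _ ≤ 3 := hCr
      obtain ⟨c, hc, _⟩ := eRk_eq_nat M (ℓ ∪ U)
      rw [hc] at h3 ⊢
      have hc' : c ≤ 3 := by exact_mod_cast h3
      have : c + 1 ≤ U.card := by omega
      exact_mod_cast this
  -- `ρ(ℓ ∪ K) ≤ ρ(ℓ ∪ U) + |K ∖ U| ≤ |K| − 1 < |K| ≤ ρ(ℓ ∪ K)`
  have hKU : ((ℓ ∪ K : Finset α) : Set α) = ((ℓ ∪ U : Finset α) : Set α) ∪ ((K \ U : Finset α) : Set α) := by
    rw [Finset.coe_union, Finset.coe_union, Finset.coe_sdiff]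
    ext x
    simp only [Set.mem_union, Set.mem_sdiff, Finset.mem_coe]
    constructor
    · rintro (hx | hx)
      · exact Or.inl (Or.inl hx)
      · by_cases hxU : x ∈ U
        · exact Or.inl (Or.inr hxU)
        · exact Or.inr ⟨hx, hxU⟩
    · rintro ((hx | hx) | ⟨hx, _⟩)
      · exact Or.inl hx
      · exact Or.inr (hUK hx)
      · exact Or.inr hx
  have hle := M.eRk_union_le_eRk_add_encard ((ℓ ∪ U : Finset α) : Set α) ((K \ U : Finset α) : Set α)
  rw [← hKU, Set.encard_coe_eq_coe_finsetCard, Finset.card_sdiff_of_subset hUK] at hle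
  have hlow := card_le_eRk_union_of_indep (ℓ := ℓ) hK
  obtain ⟨r, hr, _⟩ := eRk_eq_nat M (ℓ ∪ K)
  obtain ⟨u, hu, _⟩ := eRk_eq_nat M (ℓ ∪ U)
  rw [hr] at hle hlow
  rw [hu] at hle hrank
  have hUK' : U.card ≤ K.card := Finset.card_le_card hUK
  have h1 : r ≤ u + (K.card - U.card) := by exact_mod_cast hle
  have h2 : K.card ≤ r := by exact_mod_cast hlow
  have h3 : u + 1 ≤ U.card := by exact_mod_cast hrank
  omega

end NightThree

end PercRepro
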